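import Summits.QuantumFields.YangMills.Theorems.ColdStartUniversalityLatticeLangevinLawDensityBound
import Summits.QuantumFields.YangMills.Theorems.ColdStartUniversalityLatticeLangevinExpMixing
import Summits.QuantumFields.YangMills.Theorems.ColdStartUniversalityKLDivDensityBound
import Summits.QuantumFields.YangMills.Theorems.ColdStartUniversalityUniformColdStartMixingDictionary
import Literature.MathematicalPhysics.QuantumFieldTheory.Balaban1983to89.T4GenFunBounds
import Mathlib.InformationTheory.KullbackLeibler.Basic
import HarnessLib

/-!
# Route `ColdStartUniversality`, crux K_A1 `UniformColdStartMixing` (stmt-QuantumFields-24809), line «cold_entropy»: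
# the plan-only RUNG `stub_fixedCutoffEntropy` — FIXED-CUT-OFF COLD-START ENTROPY BUDGET AND ENTROPY DECAY

Helper file (seat `ym-line-csu-p1`, g10; `--supports stmt-QuantumFields-24809`; the registered rung node `FixedCutoffEntropy`
of the planner's skeleton `Lines_cold_entropy.lean` (ym-idea-5 g5), statement VERBATIM with the skeleton's local abbreviations
(`G2`, `su2Rep`, `avSU`, `toField`, `gibbsK`, `lawAt`, `entAt`, `IsColdStartSol`) unfolded, so that
`stub_fixedCutoffEntropy := fixedCutoffEntropy` elaborates by unfolding).

THE RUNG.  At ONE step `K` (no uniformity in the cut-off) every cold-start strong solution `U` of the SU(2) lattice Langevin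
(SZZ) dynamics at `β' = (γ ε_K)⁻¹/2` has, at the physical time `s₀ := ε_K` (lattice time `1`), relative entropy
`KL(law(U(s₀/ε_K)) ‖ μ_K) ≤ H₀` with respect to Bałaban's step-`K` Gibbs measure, and for every `η > 0` there is `T` with
`KL(law(U(s/ε_K)) ‖ μ_K) ≤ η` for all `s ≥ s₀ + T`.

THE PROOF (no log-Sobolev inequality is used).
1. `gibbsMeasure_eq_map_wilsonMeasure` — Bałaban's `gibbsMeasure (F.P K) β` IS the SZZ/Wilson measure
   `wilsonMeasure (fundamentalRep (Fin 2)) (β/2)` pushed through the bond dictionary `b ↦ (b.src, b.dir)`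
   (`expect_eq_integral_wilsonMeasure` tested on indicators).
2. `map_le_smul_wilsonMeasure_of_le` — after lattice time `1` the law of every solution from a fixed start is dominated by
   `D · μ_W`, UNIFORMLY in time (g9's `map_le_smul_haar_of_le` + `wilsonMeasure_le_smul_pi_haar_and`).
3. `exp_mixing_szz_map` (g10) — `|∫ f d law(U_t) − ∫ f dμ_W| ≤ C e^{−ct}` for measurable `|f| ≤ 1`, every start.
4. `KLDensity.klDiv_le_of_le_smul` / `KLDensity.klDiv_le_of_le_smul_of_integral_sub_le` (g10) — under `ν ≤ D·μ`:
   `KL(ν‖μ) ≤ max(1, log D)(D + 1)` and `KL(ν‖μ) ≤ max(1, log D) · TV-dual bound`.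
So `H₀ := max(1, log D)(D + 1)` and `T := ε_K (T_ℓ + 1)` with `max(1, log D) · C e^{−c T_ℓ} ≤ η`.

THEOREMS ONLY, no sorry, standard axioms.  HONEST FRAMING: a fixed-cut-off rung («exercises `entAt`, `lawAt`, `gibbsK`, `klDiv`
in a decided regime»); the constants depend on `K`; the K-UNIFORM nodes of the line (`stub_coldEntropyBudget`,
`stub_entropyDissipation`) are untouched; crux K_A1 (item ASIDE), the route, rung R3 and the summit are NOT proved; the
Yang–Mills mass gap is NOT proved.
-/

set_option autoImplicit false

noncomputable section

namespace Summit.QuantumFields.YangMills.Theorems.ColdStartUniversality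

open MeasureTheory ProbabilityTheory InformationTheory
open scoped NNReal ENNReal
open Literature.MathematicalPhysics.QuantumFieldTheory
open Literature.MathematicalPhysics.QuantumLattice (fundamentalRep fundamentalLatticeRep continuous_fundamentalRep)
open Literature.MathematicalPhysics.QuantumFieldTheory.Balaban1983to89

/-! ## §1 Bałaban's Gibbs measure is the Wilson measure read through the bond dictionary -/

/-- **Measure-level Gibbs dictionary** (`SU(2)`, `β ≥ 0`): `gibbsMeasure P β = (wilsonMeasure (fundamentalRep (Fin 2)) (β/2)).map
(U ↦ (b ↦ U (b.src, b.dir)))` — the expectation dictionary `expect_eq_integral_wilsonMeasure` tested on indicators. [folklore] -/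
theorem gibbsMeasure_eq_map_wilsonMeasure (P : Params) {β : ℝ} (hβ : 0 ≤ β) :
    T4GenFunBounds.gibbsMeasure (G := Matrix.specialUnitaryGroup (Fin 2) ℂ) P β =
      (wilsonMeasure (d := P.d) (L := P.sitesPerDir 0) (fundamentalRep (Fin 2)) (β / 2)).map
        (fun U : GaugeConfig P.d (P.sitesPerDir 0) (Matrix.specialUnitaryGroup (Fin 2) ℂ) =>
          (fun b : PBond P 0 => U (b.src, b.dir) : GaugeField P 0 (Matrix.specialUnitaryGroup (Fin 2) ℂ))) := by
  haveI := T4GenFunBounds.isProbabilityMeasure_gibbsMeasure (G := Matrix.specialUnitaryGroup (Fin 2) ℂ) P hβ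
  haveI : IsProbabilityMeasure (wilsonMeasure (d := P.d) (L := P.sitesPerDir 0) (fundamentalRep (Fin 2)) (β / 2)) :=
    isProbabilityMeasure_wilsonMeasure (d := P.d) (L := P.sitesPerDir 0) (fundamentalRep (Fin 2))
      (continuous_fundamentalRep (Fin 2)) (β / 2)
  have hΦ : Measurable fun U : GaugeConfig P.d (P.sitesPerDir 0) (Matrix.specialUnitaryGroup (Fin 2) ℂ) =>
      (fun b : PBond P 0 => U (b.src, b.dir) : GaugeField P 0 (Matrix.specialUnitaryGroup (Fin 2) ℂ)) :=
    measurable_pi_lambda _ fun b => measurable_pi_apply _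
  haveI : IsProbabilityMeasure ((wilsonMeasure (d := P.d) (L := P.sitesPerDir 0) (fundamentalRep (Fin 2)) (β / 2)).map
      (fun U : GaugeConfig P.d (P.sitesPerDir 0) (Matrix.specialUnitaryGroup (Fin 2) ℂ) =>
        (fun b : PBond P 0 => U (b.src, b.dir) : GaugeField P 0 (Matrix.specialUnitaryGroup (Fin 2) ℂ)))) :=
    Measure.isProbabilityMeasure_map hΦ.aemeasurable
  refine Measure.ext fun s hs => ?_
  have hind : AEStronglyMeasurable (s.indicator (1 : GaugeField P 0 (Matrix.specialUnitaryGroup (Fin 2) ℂ) → ℝ))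
      ((wilsonMeasure (d := P.d) (L := P.sitesPerDir 0) (fundamentalRep (Fin 2)) (β / 2)).map
        (fun U : GaugeConfig P.d (P.sitesPerDir 0) (Matrix.specialUnitaryGroup (Fin 2) ℂ) =>
          (fun b : PBond P 0 => U (b.src, b.dir) : GaugeField P 0 (Matrix.specialUnitaryGroup (Fin 2) ℂ)))) :=
    (measurable_one.indicator hs).aestronglyMeasurable
  have h1 : (T4GenFunBounds.gibbsMeasure (G := Matrix.specialUnitaryGroup (Fin 2) ℂ) P β).real s =
      ((wilsonMeasure (d := P.d) (L := P.sitesPerDir 0) (fundamentalRep (Fin 2)) (β / 2)).map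
        (fun U : GaugeConfig P.d (P.sitesPerDir 0) (Matrix.specialUnitaryGroup (Fin 2) ℂ) =>
          (fun b : PBond P 0 => U (b.src, b.dir) : GaugeField P 0 (Matrix.specialUnitaryGroup (Fin 2) ℂ)))).real s :=
    calc (T4GenFunBounds.gibbsMeasure (G := Matrix.specialUnitaryGroup (Fin 2) ℂ) P β).real s
        = ∫ x, s.indicator (1 : GaugeField P 0 (Matrix.specialUnitaryGroup (Fin 2) ℂ) → ℝ) x
            ∂(T4GenFunBounds.gibbsMeasure (G := Matrix.specialUnitaryGroup (Fin 2) ℂ) P β) :=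
          (integral_indicator_one hs).symm
      _ = Missing.expect (G := Matrix.specialUnitaryGroup (Fin 2) ℂ) P β
            (s.indicator (1 : GaugeField P 0 (Matrix.specialUnitaryGroup (Fin 2) ℂ) → ℝ)) :=
          T4GenFunBounds.integral_gibbsMeasure_eq_expect P hβ _
      _ = ∫ U, (s.indicator (1 : GaugeField P 0 (Matrix.specialUnitaryGroup (Fin 2) ℂ) → ℝ))
            ((fun b : PBond P 0 => U (b.src, b.dir) : GaugeField P 0 (Matrix.specialUnitaryGroup (Fin 2) ℂ)))
            ∂(wilsonMeasure (d := P.d) (L := P.sitesPerDir 0) (fundamentalRep (Fin 2)) (β / 2)) :=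
          expect_eq_integral_wilsonMeasure P β _
      _ = ∫ x, s.indicator (1 : GaugeField P 0 (Matrix.specialUnitaryGroup (Fin 2) ℂ) → ℝ) x
            ∂((wilsonMeasure (d := P.d) (L := P.sitesPerDir 0) (fundamentalRep (Fin 2)) (β / 2)).map
              (fun U : GaugeConfig P.d (P.sitesPerDir 0) (Matrix.specialUnitaryGroup (Fin 2) ℂ) =>
                (fun b : PBond P 0 => U (b.src, b.dir) : GaugeField P 0 (Matrix.specialUnitaryGroup (Fin 2) ℂ)))) :=
          (integral_map hΦ.aemeasurable hind).symm
      _ = _ := integral_indicator_one hs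
  exact (ENNReal.toReal_eq_toReal_iff' (measure_ne_top _ _) (measure_ne_top _ _)).mp h1

/-! ## §2 After a positive lattice time the law of the dynamics is dominated by a multiple of the Wilson measure -/

/-- **Domination of the one-time laws by the invariant measure, uniformly in time**: for every coupling `β'`, start `z` and
lattice time `t₁ > 0` there is `D ≥ 1` such that every solution from `z` on any space has `law(U_{t₁+s}) ≤ D · μ_W` for all
`s ≥ 0` (g9's `map_le_smul_haar_of_le` and `Haar ≤ a · μ_W`, `wilsonMeasure_le_smul_pi_haar_and`). [folklore] -/
theorem map_le_smul_wilsonMeasure_of_le {L : ℕ} [NeZero L] (β' : ℝ) {t₁ : ℝ≥0} (ht₁ : 0 < (t₁ : ℝ))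
    (z : GaugeConfig 3 L (Matrix.specialUnitaryGroup (Fin 2) ℂ)) :
    ∃ D : ℝ, 1 ≤ D ∧ ∀ (Ω : Type) [MeasurableSpace Ω] (P : Measure Ω) [IsProbabilityMeasure P]
      (W : ℝ≥0 → Ω → (Edge 3 L × NoiseIdx 2 → ℝ)) (hW : IsFlatBrownian W P)
      (U : ℝ≥0 → Ω → GaugeConfig 3 L (Matrix.specialUnitaryGroup (Fin 2) ℂ)), (∀ ω, U 0 ω = z) →
      (latticeLangevinDynamics (fundamentalLatticeRep 2) β').IsSolution (fundamentalRep (Fin 2)) hW.natFiltration P W U →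
      ∀ s : ℝ≥0, P.map (U (t₁ + s)) ≤ (ENNReal.ofReal D) •
        wilsonMeasure (d := 3) (L := L) (fundamentalRep (Fin 2)) β' := by
  obtain ⟨C, hC0, hC⟩ := map_le_smul_haar_of_le (L := L) β' ht₁ z
  obtain ⟨a, ha, -, hπle⟩ := wilsonMeasure_le_smul_pi_haar_and (L := L) β'
  refine ⟨max 1 (C * a), le_max_left _ _, fun Ω _ P _ W hW U hU0 hU s => ?_⟩
  have h1 := hC hW hU0 hU s
  have hCa : ENNReal.ofReal C * ENNReal.ofReal a ≤ ENNReal.ofReal (max 1 (C * a)) := by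
    rw [← ENNReal.ofReal_mul hC0]
    exact ENNReal.ofReal_le_ofReal (le_max_right _ _)
  rw [Measure.le_iff]
  intro A hA
  have e1 := Measure.le_iff.1 h1 A hA
  have e2 := Measure.le_iff.1 hπle A hA
  simp only [Measure.smul_apply, smul_eq_mul] at e1 e2 ⊢
  calc (P.map (U (t₁ + s))) A
      ≤ ENNReal.ofReal C * (Measure.pi fun _ : Edge 3 L =>
          haarProbability (Matrix.specialUnitaryGroup (Fin 2) ℂ)) A := e1
    _ ≤ ENNReal.ofReal C * (ENNReal.ofReal a * (wilsonMeasure (d := 3) (L := L) (fundamentalRep (Fin 2)) β') A) :=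
        mul_le_mul' le_rfl e2
    _ = (ENNReal.ofReal C * ENNReal.ofReal a) * (wilsonMeasure (d := 3) (L := L) (fundamentalRep (Fin 2)) β') A :=
        (mul_assoc _ _ _).symm
    _ ≤ ENNReal.ofReal (max 1 (C * a)) * (wilsonMeasure (d := 3) (L := L) (fundamentalRep (Fin 2)) β') A :=
        mul_le_mul' hCa le_rfl

/-! ## §3 The rung `FixedCutoffEntropy` -/

/-- ★ **`FixedCutoffEntropy` (registered rung `stub_fixedCutoffEntropy` of line «cold_entropy», stmt-QuantumFields-24809)** —
at ONE step `K`: there are `s₀ > 0` (`:= ε_K`) and `H₀ ≥ 0` such that for every `η > 0` there is `T > 0` with, for EVERY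
cold-start strong solution `U` of the SU(2) SZZ dynamics at `β' = (γ ε_K)⁻¹/2` on ANY probability space,
`KL(law(b ↦ U(s₀/ε_K)(b.src,b.dir)) ‖ gibbsMeasure (F.P K) β_K) ≤ H₀` and `KL(law(… U(s/ε_K) …) ‖ gibbsMeasure (F.P K) β_K) ≤ η`
for all `s ≥ s₀ + T`.  Statement = the skeleton's, local abbreviations unfolded.  Proof: §1 + §2 + uniform exponential
mixing `exp_mixing_szz_map` + the density-bound entropy lemmas of `KLDensity`; no log-Sobolev input.
[cite: HairerMattingly2011, Theorems 1.2 and 1.3] [cite: ShenZhuZhu2022, §3 Lemma 3.3 (p. 13)] -/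
theorem fixedCutoffEntropy :
    ∀ (F : T3ContinuumYM3Torus.T3Family) (γ : ℝ), 0 < γ → ∀ K : ℕ,
      ∃ s₀ H₀ : ℝ, 0 < s₀ ∧ 0 ≤ H₀ ∧
        ∀ η : ℝ, 0 < η → ∃ T : ℝ, 0 < T ∧
          ∀ (Ω : Type) (mΩ : MeasurableSpace Ω) (P : Measure Ω) (_ : IsProbabilityMeasure P)
            (W : ℝ≥0 → Ω → (Edge 3 ((F.P K).sitesPerDir 0) × NoiseIdx 2 → ℝ)) (hW : IsFlatBrownian W P)
            (U : ℝ≥0 → Ω → GaugeConfig 3 ((F.P K).sitesPerDir 0) (Matrix.specialUnitaryGroup (Fin 2) ℂ)),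
            ((∀ ω, U 0 ω = fun _ => 1) ∧
              (latticeLangevinDynamics (⟨2, fundamentalRep (Fin 2), continuous_fundamentalRep _,
                  Literature.MathematicalPhysics.QuantumLattice.fundamentalRep_injective _,
                  Literature.MathematicalPhysics.QuantumLattice.fundamentalRep_mem_unitaryGroup⟩ :
                  LatticeRep (Matrix.specialUnitaryGroup (Fin 2) ℂ)) ((γ * (F.P K).eps)⁻¹ / 2)).IsSolution
                (fundamentalRep (Fin 2)) hW.natFiltration P W U) →
            klDiv (Measure.map (fun ω => (fun b : PBond (F.P K) 0 => U (s₀ / (F.P K).eps).toNNReal ω (b.src, b.dir) :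
                  GaugeField (F.P K) 0 (Matrix.specialUnitaryGroup (Fin 2) ℂ))) P)
                (T4GenFunBounds.gibbsMeasure (F.P K)
                  ((F.scheme (ExpMeanLog.expMeanLogSU : LoopAverage (Matrix.specialUnitaryGroup (Fin 2) ℂ)) γ).β K))
              ≤ ENNReal.ofReal H₀ ∧
            ∀ s : ℝ, s₀ + T ≤ s →
              klDiv (Measure.map (fun ω => (fun b : PBond (F.P K) 0 => U (s / (F.P K).eps).toNNReal ω (b.src, b.dir) :
                    GaugeField (F.P K) 0 (Matrix.specialUnitaryGroup (Fin 2) ℂ))) P)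
                  (T4GenFunBounds.gibbsMeasure (F.P K)
                    ((F.scheme (ExpMeanLog.expMeanLogSU : LoopAverage (Matrix.specialUnitaryGroup (Fin 2) ℂ)) γ).β K))
                ≤ ENNReal.ofReal η := by
  intro F γ hγ K
  classical
  -- notation
  set ε : ℝ := (F.P K).eps with hεdef
  have hε : 0 < ε := (F.P K).eps_pos
  set β' : ℝ := (γ * ε)⁻¹ / 2 with hβ'
  have hβK : 0 ≤ (F.scheme (ExpMeanLog.expMeanLogSU : LoopAverage (Matrix.specialUnitaryGroup (Fin 2) ℂ)) γ).β K :=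
    F.scheme_β_nonneg _ hγ.le K
  set μW : Measure (GaugeConfig 3 ((F.P K).sitesPerDir 0) (Matrix.specialUnitaryGroup (Fin 2) ℂ)) :=
    wilsonMeasure (d := 3) (L := (F.P K).sitesPerDir 0) (fundamentalRep (Fin 2)) β' with hμW
  haveI hμWP : IsProbabilityMeasure μW :=
    isProbabilityMeasure_wilsonMeasure (d := 3) (L := (F.P K).sitesPerDir 0) (fundamentalRep (Fin 2))
      (continuous_fundamentalRep (Fin 2)) β'
  -- the bond dictionary
  set dict : GaugeConfig 3 ((F.P K).sitesPerDir 0) (Matrix.specialUnitaryGroup (Fin 2) ℂ) →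
      GaugeField (F.P K) 0 (Matrix.specialUnitaryGroup (Fin 2) ℂ) := fun V => fun b : PBond (F.P K) 0 => V (b.src, b.dir)
    with hdict
  have hΦ : Measurable dict := measurable_pi_lambda _ fun b => measurable_pi_apply _
  -- §1: Gibbs = Wilson through the dictionary
  have hG : T4GenFunBounds.gibbsMeasure (F.P K)
      ((F.scheme (ExpMeanLog.expMeanLogSU : LoopAverage (Matrix.specialUnitaryGroup (Fin 2) ℂ)) γ).β K) = μW.map dict :=
    gibbsMeasure_eq_map_wilsonMeasure (F.P K) hβK
  haveI : IsProbabilityMeasure (μW.map dict) := Measure.isProbabilityMeasure_map hΦ.aemeasurable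
  -- §2: density bound after lattice time `1`, from the cold start
  obtain ⟨D, hD1, hdom⟩ := map_le_smul_wilsonMeasure_of_le (L := (F.P K).sitesPerDir 0) β' (t₁ := 1)
    (by norm_num) (fun _ => 1)
  -- §3: uniform exponential mixing
  obtain ⟨C, c, hC, hc, hmix⟩ := exp_mixing_szz_map ((F.P K).sitesPerDir 0) β'
  set M : ℝ := max 1 (Real.log D) with hM
  have hM0 : 0 ≤ M := le_trans zero_le_one (le_max_left _ _)
  have hM1 : 1 ≤ M := le_max_left _ _
  refine ⟨ε, M * (D + 1), hε, mul_nonneg hM0 (by linarith), fun η hη => ?_⟩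
  -- the lattice horizon `Tl` with `M C e^{-c Tl} ≤ η`
  set A : ℝ := M * C with hA
  have hA0 : 0 < A := mul_pos (lt_of_lt_of_le one_pos hM1) hC
  set Tl : ℝ := max 0 (Real.log (A / η) / c) with hTl
  have hTl0 : 0 ≤ Tl := le_max_left _ _
  have hexp : ∀ t : ℝ, Tl ≤ t → A * Real.exp (-c * t) ≤ η := by
    intro t ht
    have hlog : Real.log (A / η) ≤ c * t := by
      have h := le_trans (le_max_right _ _) ht
      rw [div_le_iff₀ hc] at h
      linarith [mul_comm t c]
    have h1 : Real.exp (-c * t) ≤ Real.exp (-Real.log (A / η)) := Real.exp_le_exp.2 (by linarith)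
    rw [Real.exp_neg, Real.exp_log (div_pos hA0 hη), inv_div] at h1
    calc A * Real.exp (-c * t) ≤ A * (η / A) := mul_le_mul_of_nonneg_left h1 hA0.le
      _ = η := mul_div_cancel₀ η hA0.ne'
  refine ⟨ε * (Tl + 1), by positivity, fun Ω mΩ P hP W hW U hU => ?_⟩
  obtain ⟨hU0, hsol⟩ := hU
  have hmU : ∀ t : ℝ≥0, Measurable (U t) := fun t => (hsol.adapted t).mono (hW.natFiltration.le t) le_rfl
  have hprob : ∀ t : ℝ≥0, IsProbabilityMeasure (Measure.map (fun ω => dict (U t ω)) P) := fun t =>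
    Measure.isProbabilityMeasure_map ((hΦ.comp (hmU t)).aemeasurable)
  -- common facts about the law at a lattice time `t = 1 + u`
  have hlaw : ∀ u : ℝ≥0,
      Measure.map (fun ω => dict (U (1 + u) ω)) P ≤ (ENNReal.ofReal D) • (μW.map dict) ∧
      ∀ g : GaugeField (F.P K) 0 (Matrix.specialUnitaryGroup (Fin 2) ℂ) → ℝ, Measurable g → (∀ x, |g x| ≤ 1) →
        (∫ x, g x ∂(Measure.map (fun ω => dict (U (1 + u) ω)) P)) - ∫ x, g x ∂(μW.map dict) ≤
          C * Real.exp (-c * ((1 + u : ℝ≥0) : ℝ)) := by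
    intro u
    have hmm : Measure.map (fun ω => dict (U (1 + u) ω)) P = (P.map (U (1 + u))).map dict := by
      rw [Measure.map_map hΦ (hmU (1 + u))]
      rfl
    constructor
    · rw [hmm, ← Measure.map_smul]
      exact Measure.map_mono (hdom Ω P W hW U hU0 hsol u) hΦ
    · intro g hg hg1
      rw [hmm, integral_map hΦ.aemeasurable hg.aestronglyMeasurable,
        integral_map hΦ.aemeasurable hg.aestronglyMeasurable]
      exact le_trans (le_abs_self _)
        (hmix (fun _ => 1) (1 + u) (fun V => g (dict V)) (hg.comp hΦ) (fun V => hg1 _) Ω P W hW U hU0 hsol)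
  constructor
  · -- the budget at `s₀ = ε`: lattice time `1 = 1 + 0`
    have ht : (ε / (F.P K).eps).toNNReal = (1 : ℝ≥0) + 0 := by
      rw [hεdef, div_self (F.P K).eps_pos.ne', add_zero, Real.toNNReal_one]
    rw [hG, ht]
    haveI := hprob (1 + 0)
    exact KLDensity.klDiv_le_of_le_smul (ν := Measure.map (fun ω => dict (U (1 + 0) ω)) P) (μ := μW.map dict)
      hD1 (hlaw 0).1
  · intro s hs
    -- lattice time `s/ε = 1 + u` with `u ≥ Tl`
    have hsε : 1 + (Tl + 1) ≤ s / ε := by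
      rw [le_div_iff₀ hε]
      have : ε + ε * (Tl + 1) ≤ s := hs
      linarith
    have hs0 : 0 ≤ s / ε := le_trans (by positivity) hsε
    set u : ℝ≥0 := (s / ε).toNNReal - 1 with hu
    have h1le : (1 : ℝ≥0) ≤ (s / ε).toNNReal := by
      rw [← Real.toNNReal_one]
      exact Real.toNNReal_le_toNNReal (by linarith)
    have ht : (s / (F.P K).eps).toNNReal = 1 + u := by
      rw [hu, add_tsub_cancel_of_le h1le]
    have hureal : Tl ≤ ((1 + u : ℝ≥0) : ℝ) := by
      rw [← ht, Real.coe_toNNReal _ hs0]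
      linarith
    rw [hG, ht]
    haveI := hprob (1 + u)
    refine le_trans (KLDensity.klDiv_le_of_le_smul_of_integral_sub_le
      (ν := Measure.map (fun ω => dict (U (1 + u) ω)) P) (μ := μW.map dict) hD1 (hlaw u).1 (hlaw u).2) ?_
    refine ENNReal.ofReal_le_ofReal ?_
    calc M * (C * Real.exp (-c * ((1 + u : ℝ≥0) : ℝ))) = A * Real.exp (-c * ((1 + u : ℝ≥0) : ℝ)) := by
          rw [hA]; ring
      _ ≤ η := hexp _ hureal

end Summit.QuantumFields.YangMills.Theorems.ColdStartUniversality

end
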